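import Summits.Ventures.HSemireg.WedgeHankelRecurrenceGaussChebyshevCommonNodesReal

/-!
# Venture HSemireg — **THE MONIC MIXED PAIR: THE IDEAL `(C_m, S_{n−1})` OF `R[X]` FOR EVERY COMMUTATIVE RING IS `(C_{gcd(m,n)})` IF `n ∕ gcd(m,n)` IS EVEN AND `(2, S_{gcd(m,n)−1})` OTHERWISE**
# (Vieta–Lucas `C_m(x) = 2T_m(x∕2)` against Vieta–Fibonacci `S_{n−1}(x) = U_{n−1}(x∕2)`; so the «unit ideal» alternative of the `T ∕ U` statement N462 becomes `(2, S_{g−1})`, which is the unit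
# ideal iff `2` is a unit or `g = 1`): the monic product formulas **`C_m S_k = S_{k+m} + S_{k−m}`** and **`C_{k+j} − C_{k−j} = (X² − 4) S_{j−1} S_{k−1}`** (no factors `2`), the two Euclidean
# steps, the value `(C_n, S_{n−1}) = (2, S_{n−1})` (from `C_n = 2S_n − X S_{n−1}` and Cassini), and the alternating descent of N462

HONEST FRAMING. Part of the Lean index of the computation cell `pub-hsemireg` (seat p10 gen 48, Sunday typer «UNIFORM-IN-n»).  Polynomial ∕ ideal algebra and `ℕ`-parity bookkeeping only; no
variety, no cohomology theory, no sheaf, no Ext group and no semiregularity map is constructed here; nothing here says that HC / HC_CM / HC_AV holds; no Literature fact (unproved `Prop`) is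
declared or used.  Custodian versions as in `WedgeHankelSiegelIdeal` (1/3).
SOURCES (cited).  R. Lidl, G. L. Mullen, G. Turnwald, *Dickson Polynomials* (1993), Ch. 2 (Dickson polynomials of the first and second kind `D_n`, `E_n`); W. L. McDaniel, Fibonacci Quart. 29 (1991)
24–29 (the `gcd(U_m, V_n) ∈ {1, 2, V_…}` phenomenon for Lucas sequences); J. C. Mason, D. C. Handscomb, *Chebyshev Polynomials* (2003), §1.2.
PROOF TYPED HERE.  Mathlib `S_add_two ∕ S_sub_one ∕ S_add_one`, `C_add_two ∕ C_sub_one`, `C_zero ∕ C_one ∕ C_neg`, `S_neg_sub_one ∕ S_neg_one ∕ S_zero`, `C_eq_S_sub_X_mul_S`, `Polynomial.Chebyshev.induct`,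
`Ideal.span_pair_add_mul_right ∕ _add_right_mul`, `Ideal.span_insert_neg`, `Ideal.span_pair_zero`; N457 `span_pair_mul_right_of_isCoprime`; N458 bookkeeping; N465 `chebyshev_isCoprime_S_succ`.
DEDUP DISCLOSURE (`rg -n 'chebyshevC_mul_S|chebyshevC_add_sub_C_sub|chebyshevCS_span_pair' Summits Literature HarnessLib`, 2026-09-04): N438 `chebyshevT_mul_U`, N462 `chebyshevT_add_sub_T_sub` (the `T ∕ U`
forms); 0 hits for the 9 names below.

WHAT IS IN THE TREE.  N457, N458, N462, N465, N466.
THIS FILE (namespace `Summit.Ventures.HSemireg.Wedge.HankelOuter` continued; CHAINED on N480; 0 definitions):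
* §1246 **`chebyshevC_mul_S`**, **`chebyshevC_add_sub_C_sub`**, `chebyshevCS_span_pair_S_add_mul`, `chebyshevCS_span_pair_S_neg`, `chebyshevCS_span_pair_C_add_mul`, `chebyshevCS_span_pair_self`
  (`(C_n, S_{n−1}) = (2, S_{n−1})`), **`chebyshevCS_span_pair_dichotomy`**, **`chebyshevCS_span_pair_eq_span_gcd`**, **`chebyshevCS_span_pair_eq_span_two_gcd`**.
CAVEATS.  `S_{n−1}` with `n ∈ ℕ` (`S_{−1} = 0`); `ℕ`-division conventions as in N458.  Nothing Ext-side.  New names only.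
-/

open Module Polynomial
open scoped Matrix Polynomial

namespace Summit.Ventures.HSemireg.Wedge.HankelOuter

/-! ## §1246. The monic mixed ideal `(C_m, S_{n−1})` -/

/-- **Monic product formula `C_m S_k = S_{k+m} + S_{k−m}`** (all `m, k ∈ ℤ`, any commutative ring). [Lidl–Mullen–Turnwald Ch. 2; this file, §1246] -/
theorem chebyshevC_mul_S {R : Type*} [CommRing R] (m k : ℤ) :
    Polynomial.Chebyshev.C R m * Polynomial.Chebyshev.S R k = Polynomial.Chebyshev.S R (k + m) + Polynomial.Chebyshev.S R (k - m) := by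
  induction m using Polynomial.Chebyshev.induct with
  | zero => rw [Polynomial.Chebyshev.C_zero, add_zero, sub_zero, two_mul]
  | one =>
    have h := Polynomial.Chebyshev.S_add_one R k
    rw [Polynomial.Chebyshev.C_one]
    linear_combination (-1 : R[X]) * h
  | add_two m ih1 ih2 =>
    have h1 := Polynomial.Chebyshev.C_add_two R (m : ℤ)
    have h2 := Polynomial.Chebyshev.S_add_two R (k + m)
    have h3 := Polynomial.Chebyshev.S_sub_one R (k - m - 1)
    linear_combination (norm := ring_nf) Polynomial.Chebyshev.S R k * h1 + (X : R[X]) * ih1 - ih2 - h2 - h3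
  | neg_add_one m ih1 ih2 =>
    have h1 := Polynomial.Chebyshev.C_sub_one R (-(m : ℤ))
    have h2 := Polynomial.Chebyshev.S_sub_one R (k - m)
    have h3 := Polynomial.Chebyshev.S_add_two R (k + m - 1)
    linear_combination (norm := ring_nf) Polynomial.Chebyshev.S R k * h1 + (X : R[X]) * ih1 - ih2 - h2 - h3

/-- **`C_{k+j} − C_{k−j} = (X² − 4) S_{j−1} S_{k−1}`** (all `j, k ∈ ℤ`, any commutative ring). [Lidl–Mullen–Turnwald Ch. 2; this file, §1246] -/
theorem chebyshevC_add_sub_C_sub {R : Type*} [CommRing R] (j k : ℤ) :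
    Polynomial.Chebyshev.C R (k + j) - Polynomial.Chebyshev.C R (k - j) =
      (Polynomial.X ^ 2 - 4) * Polynomial.Chebyshev.S R (j - 1) * Polynomial.Chebyshev.S R (k - 1) := by
  induction j using Polynomial.Chebyshev.induct with
  | zero => simp only [add_zero, sub_zero, sub_self, zero_sub, Polynomial.Chebyshev.S_neg_one, mul_zero, zero_mul]
  | one =>
    have h1 := Polynomial.Chebyshev.C_eq_S_sub_X_mul_S R (k + 1)
    have h2 := Polynomial.Chebyshev.C_eq_S_sub_X_mul_S R (k - 1)
    have h3 := Polynomial.Chebyshev.S_add_one R k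
    have h4 := Polynomial.Chebyshev.S_sub_one R (k - 1)
    have hS0 := Polynomial.Chebyshev.S_zero R
    linear_combination (norm := ring_nf) h1 - h2 + 2 * h3 + (X : R[X]) * h4 - (X ^ 2 - 4 : R[X]) * Polynomial.Chebyshev.S R (k - 1) * hS0
  | add_two j ih1 ih2 =>
    have h1 := Polynomial.Chebyshev.C_add_two R (k + j)
    have h2 := Polynomial.Chebyshev.C_sub_two R (k - j)
    have h3 := Polynomial.Chebyshev.S_add_two R ((j : ℤ) - 1)
    linear_combination (norm := ring_nf) h1 - h2 + (X : R[X]) * ih1 - ih2 - (X ^ 2 - 4 : R[X]) * Polynomial.Chebyshev.S R (k - 1) * h3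
  | neg_add_one j ih1 ih2 =>
    have h1 := Polynomial.Chebyshev.C_add_two R (k + (-(j : ℤ)) - 1)
    have h2 := Polynomial.Chebyshev.C_add_two R (k - (-(j : ℤ)) - 1)
    have h3 := Polynomial.Chebyshev.S_sub_one R (-(j : ℤ) - 1)
    linear_combination (norm := ring_nf) h1 - h2 + (X : R[X]) * ih1 - ih2 - (X ^ 2 - 4 : R[X]) * Polynomial.Chebyshev.S R (k - 1) * h3

/-- `(S_{k + t·2m}, C_m) = (S_k, C_m)` for every `t ∈ ℤ` (Euclidean step `(S_{k+m}, C_m) = (S_{k−m}, C_m)` iterated). [this file, §1246] -/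
theorem chebyshevCS_span_pair_S_add_mul {R : Type*} [CommRing R] (k m t : ℤ) :
    Ideal.span {Polynomial.Chebyshev.S R (k + t * (2 * m)), Polynomial.Chebyshev.C R m} = Ideal.span {Polynomial.Chebyshev.S R k, Polynomial.Chebyshev.C R m} := by
  have step1 : ∀ k' : ℤ, Ideal.span {Polynomial.Chebyshev.S R (k' + m), Polynomial.Chebyshev.C R m} = Ideal.span {Polynomial.Chebyshev.S R (k' - m), Polynomial.Chebyshev.C R m} := fun k' => by
    have h : Polynomial.Chebyshev.S R (k' + m) = -Polynomial.Chebyshev.S R (k' - m) + Polynomial.Chebyshev.S R k' * Polynomial.Chebyshev.C R m := by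
      linear_combination (-1 : R[X]) * chebyshevC_mul_S (R := R) m k'
    rw [h, Ideal.span_pair_add_mul_right, Ideal.span_insert_neg]
  have step : ∀ k' : ℤ, Ideal.span {Polynomial.Chebyshev.S R (k' + 2 * m), Polynomial.Chebyshev.C R m} = Ideal.span {Polynomial.Chebyshev.S R k', Polynomial.Chebyshev.C R m} := fun k' => by
    rw [show k' + 2 * m = (k' + m) + m by ring, step1, add_sub_cancel_right]
  induction t using Int.induction_on with
  | zero => rw [zero_mul, add_zero]
  | succ i ih => rw [add_mul, one_mul, ← add_assoc, step, ih]
  | pred i ih =>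
    have h := step (k + (-(i : ℤ) - 1) * (2 * m))
    rw [show k + (-(i : ℤ) - 1) * (2 * m) + 2 * m = k + (-(i : ℤ)) * (2 * m) by ring, ih] at h
    exact h.symm

/-- Reflection `(S_{−n−1}, C_m) = (S_{n−1}, C_m)`. [this file, §1246] -/
theorem chebyshevCS_span_pair_S_neg {R : Type*} [CommRing R] (n m : ℤ) :
    Ideal.span {Polynomial.Chebyshev.S R (-n - 1), Polynomial.Chebyshev.C R m} = Ideal.span {Polynomial.Chebyshev.S R (n - 1), Polynomial.Chebyshev.C R m} := by
  rw [Polynomial.Chebyshev.S_neg_sub_one, Ideal.span_insert_neg]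

/-- `(C_{k + t·2j}, S_{j−1}) = (C_k, S_{j−1})` for every `t ∈ ℤ` (Euclidean step `(C_{k+j}, S_{j−1}) = (C_{k−j}, S_{j−1})` iterated). [this file, §1246] -/
theorem chebyshevCS_span_pair_C_add_mul {R : Type*} [CommRing R] (k j t : ℤ) :
    Ideal.span {Polynomial.Chebyshev.C R (k + t * (2 * j)), Polynomial.Chebyshev.S R (j - 1)} = Ideal.span {Polynomial.Chebyshev.C R k, Polynomial.Chebyshev.S R (j - 1)} := by
  have step1 : ∀ k' : ℤ, Ideal.span {Polynomial.Chebyshev.C R (k' + j), Polynomial.Chebyshev.S R (j - 1)} = Ideal.span {Polynomial.Chebyshev.C R (k' - j), Polynomial.Chebyshev.S R (j - 1)} := fun k' => by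
    have h : Polynomial.Chebyshev.C R (k' + j) = Polynomial.Chebyshev.C R (k' - j) + Polynomial.Chebyshev.S R (j - 1) * ((Polynomial.X ^ 2 - 4) * Polynomial.Chebyshev.S R (k' - 1)) := by
      linear_combination chebyshevC_add_sub_C_sub (R := R) j k'
    rw [h, Ideal.span_pair_add_right_mul]
  have step : ∀ k' : ℤ, Ideal.span {Polynomial.Chebyshev.C R (k' + 2 * j), Polynomial.Chebyshev.S R (j - 1)} = Ideal.span {Polynomial.Chebyshev.C R k', Polynomial.Chebyshev.S R (j - 1)} := fun k' => by
    rw [show k' + 2 * j = (k' + j) + j by ring, step1, add_sub_cancel_right]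
  induction t using Int.induction_on with
  | zero => rw [zero_mul, add_zero]
  | succ i ih => rw [add_mul, one_mul, ← add_assoc, step, ih]
  | pred i ih =>
    have h := step (k + (-(i : ℤ) - 1) * (2 * j))
    rw [show k + (-(i : ℤ) - 1) * (2 * j) + 2 * j = k + (-(i : ℤ)) * (2 * j) by ring, ih] at h
    exact h.symm

/-- **`(C_n, S_{n−1}) = (2, S_{n−1})`** (any commutative ring; `C_n = 2 S_n − X S_{n−1}` and the Cassini coprimality of `S_n`, `S_{n−1}`). [this file, §1246] -/
theorem chebyshevCS_span_pair_self {R : Type*} [CommRing R] (n : ℤ) :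
    Ideal.span {Polynomial.Chebyshev.C R n, Polynomial.Chebyshev.S R (n - 1)} = Ideal.span {2, Polynomial.Chebyshev.S R (n - 1)} := by
  have h : Polynomial.Chebyshev.C R n = 2 * Polynomial.Chebyshev.S R n + Polynomial.Chebyshev.S R (n - 1) * (-Polynomial.X) := by
    rw [Polynomial.Chebyshev.C_eq_S_sub_X_mul_S]; ring
  have hcop : IsCoprime (Polynomial.Chebyshev.S R n) (Polynomial.Chebyshev.S R (n - 1)) := by
    have h' := chebyshev_isCoprime_S_succ (R := R) (n - 1)
    rwa [sub_add_cancel] at h'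
  rw [h, Ideal.span_pair_add_right_mul, span_pair_mul_right_of_isCoprime hcop]

/-- **Dichotomy for the monic mixed ideal `(C_m, S_{n−1})` (any commutative ring): `= (C_{gcd(m,n)})` if `n ∕ gcd(m,n)` is even, `= (2, S_{gcd(m,n)−1})` otherwise.** [this file, §1246] -/
theorem chebyshevCS_span_pair_dichotomy {R : Type*} [CommRing R] (m n : ℕ) :
    (Even (n / Nat.gcd m n) →
        Ideal.span {Polynomial.Chebyshev.C R (m : ℤ), Polynomial.Chebyshev.S R ((n : ℤ) - 1)} = Ideal.span {Polynomial.Chebyshev.C R (Nat.gcd m n : ℤ)}) ∧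
      (¬ Even (n / Nat.gcd m n) →
        Ideal.span {Polynomial.Chebyshev.C R (m : ℤ), Polynomial.Chebyshev.S R ((n : ℤ) - 1)} = Ideal.span {2, Polynomial.Chebyshev.S R ((Nat.gcd m n : ℤ) - 1)}) := by
  obtain ⟨s, hs⟩ : ∃ s, m + n = s := ⟨_, rfl⟩
  induction s using Nat.strong_induction_on generalizing m n with
  | _ s ih =>
  rcases Nat.eq_zero_or_pos n with rfl | hn
  · -- `S_{−1} = 0`
    refine ⟨fun _ => ?_, fun h => absurd (by rw [Nat.zero_div]; exact Even.zero) h⟩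
    rw [Nat.cast_zero, zero_sub, Polynomial.Chebyshev.S_neg_one, Ideal.span_pair_zero, Nat.gcd_zero_right]
  rcases Nat.eq_zero_or_pos m with rfl | hm
  · -- `C_0 = 2`
    rw [Nat.gcd_zero_left, Nat.div_self hn]
    refine ⟨fun h => absurd h Nat.not_even_one, fun _ => ?_⟩
    rw [Nat.cast_zero, Polynomial.Chebyshev.C_zero]
  rcases lt_trichotomy m n with hlt | rfl | hgt
  · -- `m < n`: fold `n` modulo `2m`
    obtain ⟨j, hjm, q, hj⟩ := exists_fold_mod_two_mul hm n
    have hred : Ideal.span {Polynomial.Chebyshev.C R (m : ℤ), Polynomial.Chebyshev.S R ((n : ℤ) - 1)} =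
        Ideal.span {Polynomial.Chebyshev.C R (m : ℤ), Polynomial.Chebyshev.S R ((j : ℤ) - 1)} ∧
        Nat.gcd m n = Nat.gcd m j ∧ (Odd (n / Nat.gcd m j) ↔ Odd (j / Nat.gcd m j)) := by
      rcases hj with hj | hj
      · refine ⟨?_, gcd_eq_and_odd_div_iff_of_eq_add hj⟩
        rw [Ideal.span_pair_comm, hj, show (((j + 2 * m * q : ℕ)) : ℤ) - 1 = ((j : ℤ) - 1) + (q : ℤ) * (2 * m) by push_cast; ring,
          chebyshevCS_span_pair_S_add_mul, Ideal.span_pair_comm]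
      · refine ⟨?_, gcd_eq_and_odd_div_iff_of_add_eq hj⟩
        have hz : (n : ℤ) - 1 = (-(j : ℤ) - 1) + (q : ℤ) * (2 * m) := by
          have e := congrArg (Nat.cast : ℕ → ℤ) hj
          push_cast at e
          linarith
        rw [Ideal.span_pair_comm, hz, chebyshevCS_span_pair_S_add_mul, chebyshevCS_span_pair_S_neg, Ideal.span_pair_comm]
    obtain ⟨hideal, hg1, hg2⟩ := hred
    have h := ih (m + j) (by omega) m j rfl
    rw [hideal, hg1, ← Nat.not_odd_iff_even, hg2, Nat.not_odd_iff_even]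
    exact h
  · -- `m = n ≥ 1`: `(C_m, S_{m−1}) = (2, S_{m−1})`
    rw [Nat.gcd_self, Nat.div_self hm]
    exact ⟨fun h => absurd h Nat.not_even_one, fun _ => chebyshevCS_span_pair_self (R := R) (m : ℤ)⟩
  · -- `m > n`: fold `m` modulo `2n`
    obtain ⟨i, hin, q, hi⟩ := exists_fold_mod_two_mul hn m
    have hred : Ideal.span {Polynomial.Chebyshev.C R (m : ℤ), Polynomial.Chebyshev.S R ((n : ℤ) - 1)} =
        Ideal.span {Polynomial.Chebyshev.C R (i : ℤ), Polynomial.Chebyshev.S R ((n : ℤ) - 1)} ∧ Nat.gcd m n = Nat.gcd i n := by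
      rcases hi with hi | hi
      · refine ⟨?_, by rw [Nat.gcd_comm, (gcd_eq_and_odd_div_iff_of_eq_add hi).1, Nat.gcd_comm]⟩
        rw [hi, show (((i + 2 * n * q : ℕ)) : ℤ) = (i : ℤ) + (q : ℤ) * (2 * n) by push_cast; ring, chebyshevCS_span_pair_C_add_mul]
      · refine ⟨?_, by rw [Nat.gcd_comm, (gcd_eq_and_odd_div_iff_of_add_eq hi).1, Nat.gcd_comm]⟩
        have hz : (m : ℤ) = -(i : ℤ) + (q : ℤ) * (2 * n) := by
          have e := congrArg (Nat.cast : ℕ → ℤ) hi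
          push_cast at e
          linarith
        rw [hz, chebyshevCS_span_pair_C_add_mul, Polynomial.Chebyshev.C_neg]
    obtain ⟨hideal, hg1⟩ := hred
    have h := ih (i + n) (by omega) i n rfl
    rw [hideal, hg1]
    exact h

/-- **`(C_m, S_{n−1}) = (C_{gcd(m,n)})` when `n ∕ gcd(m,n)` is even** (any commutative ring). [this file, §1246] -/
theorem chebyshevCS_span_pair_eq_span_gcd {R : Type*} [CommRing R] {m n : ℕ} (h : Even (n / Nat.gcd m n)) :
    Ideal.span {Polynomial.Chebyshev.C R (m : ℤ), Polynomial.Chebyshev.S R ((n : ℤ) - 1)} = Ideal.span {Polynomial.Chebyshev.C R (Nat.gcd m n : ℤ)} :=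
  (chebyshevCS_span_pair_dichotomy m n).1 h

/-- **`(C_m, S_{n−1}) = (2, S_{gcd(m,n)−1})` when `n ∕ gcd(m,n)` is odd** (any commutative ring). [this file, §1246] -/
theorem chebyshevCS_span_pair_eq_span_two_gcd {R : Type*} [CommRing R] {m n : ℕ} (h : ¬ Even (n / Nat.gcd m n)) :
    Ideal.span {Polynomial.Chebyshev.C R (m : ℤ), Polynomial.Chebyshev.S R ((n : ℤ) - 1)} = Ideal.span {2, Polynomial.Chebyshev.S R ((Nat.gcd m n : ℤ) - 1)} :=
  (chebyshevCS_span_pair_dichotomy m n).2 h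

end Summit.Ventures.HSemireg.Wedge.HankelOuter
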